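import Summits.Parity.GeneralizedHardyLittlewood.Theorems.FordMaynardSieveConst01651SieveConst01651SliceKernel
import Literature.NumberTheory.Sieve.FordMaynardSliceConvolution
import Literature.Analysis.Convolution.OneSidedConvolutionPowers
import HarnessLib

/-!
# Route `FordMaynardSieveConst01651`, target `SieveConst01651` (stmt-Parity-19185), stub `stub_certValuePos` (R2):
# the kernels `F_m` are convolution powers, and the Buchstab function `Φ = Σ F_m/m!` solves a Volterra equation

Def-free helper file.  The residue `hV : 0 < sieveBoundG1 (1651/10000) coneCert` (`…CertValue.coneCert_value_pos_iff`)
is a finite combination of the universal kernels `F_m(s) = ∫_{u ∈ (ν,∞)^m, |u| = s} du/(u₁⋯u_m)`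
(`sliceIntegral m s (𝟙[uᵢ > ν]/∏ uᵢ)`).  Here:

* `boxMu`-calculus: `φ_ν(t) = 𝟙[t > ν]/t` is locally bounded (`locBdd_boxMu`), `t·φ_ν(t) = 𝟙[t > ν]`;
* `kernel_eq_cpow` — **`F_m = φ_ν^{⋆m}`** (`m ≥ 1`, `s > 0`): the kernel is the `m`-fold one-sided convolution power
  (`Literature.Analysis.Convolution.cpow`) of `φ_ν`, by the tree's `sliceIntegral_prod_eq_cpow`;
* `oconv_boxStep_eq` — `(f ⋆ 𝟙[· > ν])(x) = ∫_{(0, x−ν]} f`;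
* `buchstab_volterra` — for `Φ_M(x) = Σ_{m=1}^{M} φ_ν^{⋆m}(x)/m!` and every `x`:
  **`x·Φ_{M+1}(x) = 𝟙[x > ν] + ∫_{(0, x−ν]} Φ_M`** (the derivation rule `x f^{⋆(n+1)} = (n+1)(f^{⋆n} ⋆ Df)`,
  `D φ_ν = 𝟙[· > ν]`), and `buchstab_volterra_six` — with `M = 6` on BOTH sides for `x < 7ν` (the `m = 7` power vanishes
  below `7ν`); this is Buchstab's equation `(uω(u))' = ω(u−1)` for `Φ(s) = ω(s/ν)/ν`, with no special function named;
* `buchstabPhi_nonneg`, `buchstabPhi_eq_zero_of_le` (`Φ = 0` on `(−∞, ν]`), `locBdd_buchstabPhi`.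

These turn the twelve integrals of `hV` into ONE function `Φ` on `[1/2, 1]` computable by a monotone integer recursion
(the certificate of the next files).

References: [FordMaynard2024PrimeSieves] arXiv:2407.14368, Theorem 7.3 (a), §8.2; A. A. Buchstab (1937) (the function ω).
-/

noncomputable section

open MeasureTheory Set Finset
open Literature.NumberTheory.Sieve Literature.NumberTheory.Sieve.FordMaynard
open Literature.Analysis.Convolution

namespace Summit.Parity.GeneralizedHardyLittlewood.FordMaynardSieveConst01651SieveConst01651

/-! ### The one-variable function `φ_ν(t) = 𝟙[t > ν]/t` -/

/-- `φ_ν(t) = 0` for `t ≤ ν`. [folklore] -/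
theorem boxMu_of_le {ν t : ℝ} (h : t ≤ ν) : (fun t : ℝ => if ν < t then 1 / t else 0) t = 0 := by
  simp [not_lt.2 h]

/-- `φ_ν(t) = 1/t` for `t > ν`. [folklore] -/
theorem boxMu_of_lt {ν t : ℝ} (h : ν < t) : (fun t : ℝ => if ν < t then 1 / t else 0) t = 1 / t := by
  simp [h]

/-- `φ_ν ≥ 0` for `ν ≥ 0`. [folklore] -/
theorem boxMu_nonneg {ν : ℝ} (hν : 0 ≤ ν) (t : ℝ) : 0 ≤ (fun t : ℝ => if ν < t then 1 / t else 0) t := by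
  by_cases h : ν < t
  · simp only [h, if_true]; exact (one_div_pos.2 (hν.trans_lt h)).le
  · simp [h]

/-- `φ_ν` is locally bounded and measurable (bounded by `1/ν`). [folklore] -/
theorem locBdd_boxMu {ν : ℝ} (hν : 0 < ν) : LocBdd (fun t : ℝ => if ν < t then 1 / t else 0) := by
  refine ⟨Measurable.ite measurableSet_Ioi (measurable_const.div measurable_id) measurable_const,
    fun A => ⟨1 / ν, fun t _ => ?_⟩⟩
  by_cases h : ν < t
  · simp only [h, if_true]
    rw [abs_of_pos (one_div_pos.2 (hν.trans h))]
    exact one_div_le_one_div_of_le hν h.le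
  · simp only [h, if_false, abs_zero]; positivity

/-- `t·φ_ν(t) = 𝟙[t > ν]` (`D φ_ν` is the open step at `ν`), for `ν ≥ 0`. [folklore] -/
theorem id_mul_boxMu {ν : ℝ} (hν : 0 ≤ ν) (t : ℝ) :
    t * (fun t : ℝ => if ν < t then 1 / t else 0) t = if ν < t then 1 else 0 := by
  by_cases h : ν < t
  · simp only [h, if_true]; field_simp [(hν.trans_lt h).ne']
  · simp [h]

/-- The open step `𝟙[· > ν]` is locally bounded and measurable. [folklore] -/
theorem locBdd_boxStep (ν : ℝ) : LocBdd (fun t : ℝ => if ν < t then (1 : ℝ) else 0) :=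
  ⟨Measurable.ite measurableSet_Ioi measurable_const measurable_const,
    fun A => ⟨1, fun t _ => by by_cases h : ν < t <;> simp [h]⟩⟩

/-! ### The kernels are convolution powers -/

/-- **`F_m = φ_ν^{⋆m}`**: for `ν > 0`, `m ≥ 1` and `s > 0`,
`∫_{u ∈ (0,∞)^m, |u| = s} 𝟙[uᵢ > ν ∀ i]/(u₁⋯u_m) du = φ_ν^{⋆m}(s)` (`cpow`), since on the slice the integrand is the
product `∏ φ_ν(uᵢ)`. [folklore] -/
theorem kernel_eq_cpow {ν : ℝ} (hν : 0 < ν) {m : ℕ} (hm : 1 ≤ m) {s : ℝ} (hs : 0 < s) :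
    sliceIntegral m s (fun u => if ∀ i, ν < u i then 1 / ∏ i, u i else 0) =
      cpow (fun t : ℝ => if ν < t then 1 / t else 0) m s := by
  obtain ⟨d, rfl⟩ : ∃ d, m = d + 1 := ⟨m - 1, by omega⟩
  rw [← sliceIntegral_prod_eq_cpow (locBdd_boxMu hν) d hs]
  refine sliceIntegral_congr fun u _ _ => ?_
  by_cases h : ∀ i, ν < u i
  · rw [if_pos h]
    have : ∀ i, (fun t : ℝ => if ν < t then 1 / t else 0) (u i) = 1 / u i := fun i => by simp [h i]
    simp only [this, Finset.prod_div_distrib, Finset.prod_const_one]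
  · rw [if_neg h]
    push Not at h
    obtain ⟨i, hi⟩ := h
    symm
    exact Finset.prod_eq_zero (Finset.mem_univ i) (by simp [not_lt.2 hi])

/-! ### Convolution with the open step -/

/-- `(f ⋆ 𝟙[· > ν])(x) = ∫_{0 < t ≤ x − ν} f(t) dt` for `ν ≥ 0`. [folklore] -/
theorem oconv_boxStep_eq (f : ℝ → ℝ) {ν : ℝ} (hν : 0 ≤ ν) (x : ℝ) :
    oconv f (fun t : ℝ => if ν < t then (1 : ℝ) else 0) x = ∫ t in Set.Ioc 0 (x - ν), f t := by
  rw [oconv]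
  have h1 : (fun t => f t * (fun t : ℝ => if ν < t then (1 : ℝ) else 0) (x - t)) = (Set.Iio (x - ν)).indicator f := by
    funext t
    simp only [Set.indicator, Set.mem_Iio]
    by_cases h : t < x - ν
    · rw [if_pos (by linarith), if_pos h, mul_one]
    · rw [if_neg (by linarith), if_neg h, mul_zero]
  rw [h1, setIntegral_indicator measurableSet_Iio]
  have hset : Set.Ioc 0 x ∩ Set.Iio (x - ν) = Set.Ioo 0 (x - ν) := by
    ext t
    simp only [Set.mem_inter_iff, Set.mem_Ioc, Set.mem_Iio, Set.mem_Ioo]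
    constructor
    · rintro ⟨⟨h1, _⟩, h3⟩; exact ⟨h1, h3⟩
    · rintro ⟨h1, h2⟩; exact ⟨⟨h1, by linarith⟩, h2⟩
  rw [hset]
  exact setIntegral_congr_set Ioo_ae_eq_Ioc

/-! ### The Buchstab function `Φ_M = Σ_{m ≤ M} φ_ν^{⋆m}/m!` and its Volterra equation -/

/-- `Φ_M ≥ 0` (`ν ≥ 0`). [folklore] -/
theorem buchstabPhi_nonneg {ν : ℝ} (hν : 0 ≤ ν) (M : ℕ) (x : ℝ) :
    0 ≤ ∑ m ∈ Finset.Icc 1 M, (1 / (m.factorial : ℝ)) * cpow (fun t : ℝ => if ν < t then 1 / t else 0) m x :=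
  Finset.sum_nonneg fun m _ => mul_nonneg (by positivity) (cpow_nonneg (boxMu_nonneg hν) m x)

/-- `Φ_M(x) = 0` for `x ≤ ν` (`ν > 0`): every power `φ_ν^{⋆m}`, `m ≥ 1`, vanishes below `mν ≥ ν`, and `φ_ν(ν) = 0`.
[folklore] -/
theorem buchstabPhi_eq_zero_of_le {ν : ℝ} (hν : 0 < ν) (M : ℕ) {x : ℝ} (hx : x ≤ ν) :
    ∑ m ∈ Finset.Icc 1 M, (1 / (m.factorial : ℝ)) * cpow (fun t : ℝ => if ν < t then 1 / t else 0) m x = 0 := by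
  refine Finset.sum_eq_zero fun m hm => ?_
  rw [Finset.mem_Icc] at hm
  rcases eq_or_lt_of_le hm.1 with h1 | h1
  · rw [← h1, cpow_one]
    simp [not_lt.2 hx]
  · rw [cpow_eq_zero_of_lt (η := ν) (fun t ht => boxMu_of_le ht.le) (by omega) ?_, mul_zero]
    have : (1 : ℝ) * ν < m * ν := mul_lt_mul_of_pos_right (by exact_mod_cast h1) hν
    linarith

/-- `Φ_M` is locally bounded and measurable. [folklore] -/
theorem locBdd_buchstabPhi {ν : ℝ} (hν : 0 < ν) (M : ℕ) :
    LocBdd (fun x => ∑ m ∈ Finset.Icc 1 M, (1 / (m.factorial : ℝ)) *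
      cpow (fun t : ℝ => if ν < t then 1 / t else 0) m x) :=
  LocBdd.sum _ fun m _ => ((locBdd_boxMu hν).cpow m).const_mul _

/-- **Buchstab's Volterra equation** (derivation rule for convolution powers): for `ν > 0`, every `M` and every `x`,
`x · Φ_{M+1}(x) = 𝟙[x > ν] + ∫_{(0, x−ν]} Φ_M(t) dt`, where `Φ_M = Σ_{m=1}^{M} φ_ν^{⋆m}/m!`.  (Term by term:
`x φ_ν(x) = 𝟙[x > ν]` and `x φ_ν^{⋆(n+1)}(x)/(n+1)! = (φ_ν^{⋆n} ⋆ 𝟙[· > ν])(x)/n! = (1/n!)∫_{(0,x−ν]} φ_ν^{⋆n}`.)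
[cite: FordMaynard2024PrimeSieves, §8.2 (the kernels of Theorem 7.3 (a)); Buchstab's identity (uω(u))' = ω(u−1)] -/
theorem buchstab_volterra {ν : ℝ} (hν : 0 < ν) (M : ℕ) (x : ℝ) :
    x * ∑ m ∈ Finset.Icc 1 (M + 1), (1 / (m.factorial : ℝ)) * cpow (fun t : ℝ => if ν < t then 1 / t else 0) m x =
      (if ν < x then 1 else 0) + ∫ t in Set.Ioc 0 (x - ν),
        ∑ m ∈ Finset.Icc 1 M, (1 / (m.factorial : ℝ)) * cpow (fun t : ℝ => if ν < t then 1 / t else 0) m t := by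
  set φ : ℝ → ℝ := fun t => if ν < t then 1 / t else 0 with hφ
  have hφb : LocBdd φ := locBdd_boxMu hν
  -- split off `m = 1` and shift the index
  rw [Finset.mul_sum]
  have hsplit : ∑ m ∈ Finset.Icc 1 (M + 1), x * ((1 / (m.factorial : ℝ)) * cpow φ m x) =
      x * ((1 / ((1 : ℕ).factorial : ℝ)) * cpow φ 1 x) +
        ∑ n ∈ Finset.Icc 1 M, x * ((1 / ((n + 1).factorial : ℝ)) * cpow φ (n + 1) x) := by
    have h1 : Finset.Icc 1 (M + 1) = insert 1 (Finset.Icc 2 (M + 1)) := by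
      ext m; simp only [Finset.mem_Icc, Finset.mem_insert]; omega
    rw [h1, Finset.sum_insert (by simp)]
    congr 1
    have h2 : Finset.Icc 2 (M + 1) = (Finset.Icc 1 M).map ⟨fun n => n + 1, fun a b h => by simpa using h⟩ := by
      ext m
      simp only [Finset.mem_Icc, Finset.mem_map, Function.Embedding.coeFn_mk]
      constructor
      · intro h; exact ⟨m - 1, by omega, by omega⟩
      · rintro ⟨n, hn, rfl⟩; omega
    rw [h2, Finset.sum_map]
    rfl
  rw [hsplit]
  -- the `m = 1` term
  have hone : x * ((1 / ((1 : ℕ).factorial : ℝ)) * cpow φ 1 x) = if ν < x then 1 else 0 := by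
    rw [cpow_one, Nat.factorial_one, Nat.cast_one, div_one, one_mul, hφ, id_mul_boxMu hν.le]
  rw [hone]
  congr 1
  -- the terms `m = n + 1 ≥ 2`
  have hterm : ∀ n ∈ Finset.Icc 1 M, x * ((1 / ((n + 1).factorial : ℝ)) * cpow φ (n + 1) x) =
      ∫ t in Set.Ioc 0 (x - ν), (1 / (n.factorial : ℝ)) * cpow φ n t := by
    intro n hn
    rw [Finset.mem_Icc] at hn
    have hder := id_mul_cpow_succ hφb hn.1 x
    have hD : (fun t => t * φ t) = fun t : ℝ => if ν < t then (1 : ℝ) else 0 := by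
      funext t; rw [hφ]; exact id_mul_boxMu hν.le t
    rw [hD, oconv_boxStep_eq _ hν.le] at hder
    rw [integral_const_mul]
    have hfac : ((n + 1).factorial : ℝ) = (n + 1 : ℝ) * (n.factorial : ℝ) := by
      rw [Nat.factorial_succ]; push_cast; ring
    have hn0 : (n.factorial : ℝ) ≠ 0 := by positivity
    have hn1 : (n + 1 : ℝ) ≠ 0 := by positivity
    calc x * ((1 / ((n + 1).factorial : ℝ)) * cpow φ (n + 1) x)
        = (1 / ((n + 1).factorial : ℝ)) * (x * cpow φ (n + 1) x) := by ring
      _ = (1 / ((n + 1).factorial : ℝ)) * ((n + 1 : ℝ) * ∫ t in Set.Ioc 0 (x - ν), cpow φ n t) := by rw [hder]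
      _ = (1 / (n.factorial : ℝ)) * ∫ t in Set.Ioc 0 (x - ν), cpow φ n t := by
          rw [hfac]; field_simp
  rw [Finset.sum_congr rfl hterm, ← integral_finsetSum _ (fun n _ => ((hφb.cpow n).const_mul _).integrableOn_Ioc _ _)]

/-- **Buchstab's Volterra equation below `7ν`, closed in `Φ₆`**: for `ν > 0` and `x < 7ν`,
`x · Φ₆(x) = 𝟙[x > ν] + ∫_{(0, x−ν]} Φ₆(t) dt` — on `(0, x − ν] ⊆ (−∞, 6ν)` the sixth power in `Φ₆` vanishes, so
`Φ₅ = Φ₆` there.  At `ν = 0.1651` (`7ν > 1`) this covers every argument the certificate value needs.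
[cite: FordMaynard2024PrimeSieves, §8.2; Buchstab's identity] -/
theorem buchstab_volterra_six {ν : ℝ} (hν : 0 < ν) {x : ℝ} (hx : x < 7 * ν) :
    x * ∑ m ∈ Finset.Icc 1 6, (1 / (m.factorial : ℝ)) * cpow (fun t : ℝ => if ν < t then 1 / t else 0) m x =
      (if ν < x then 1 else 0) + ∫ t in Set.Ioc 0 (x - ν),
        ∑ m ∈ Finset.Icc 1 6, (1 / (m.factorial : ℝ)) * cpow (fun t : ℝ => if ν < t then 1 / t else 0) m t := by
  rw [show (6 : ℕ) = 5 + 1 from rfl, buchstab_volterra hν 5 x]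
  congr 1
  refine setIntegral_congr_fun measurableSet_Ioc fun t ht => ?_
  -- `Φ₆(t) = Φ₅(t) + φ^{⋆6}(t)/6!` and the last term vanishes for `t ≤ x − ν < 6ν`
  rw [show (5 + 1 : ℕ) = 6 from rfl]
  have h6 : Finset.Icc 1 6 = insert 6 (Finset.Icc 1 5) := by
    ext m; simp only [Finset.mem_Icc, Finset.mem_insert]; omega
  rw [h6, Finset.sum_insert (by simp)]
  have hz : cpow (fun t : ℝ => if ν < t then 1 / t else 0) 6 t = 0 :=
    cpow_eq_zero_of_lt (η := ν) (fun s hs => boxMu_of_le hs.le) (by norm_num) (by push_cast; linarith [ht.2])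
  rw [hz, mul_zero, zero_add]

/-- **The primitive `Ψ(y) = ∫_{(0,y]} Φ₆` is monotone** (`Φ₆ ≥ 0`). [folklore] -/
theorem buchstabPsi_mono {ν : ℝ} (hν : 0 < ν) {y y' : ℝ} (hyy' : y ≤ y') :
    ∫ t in Set.Ioc 0 y, ∑ m ∈ Finset.Icc 1 6, (1 / (m.factorial : ℝ)) *
        cpow (fun t : ℝ => if ν < t then 1 / t else 0) m t ≤
      ∫ t in Set.Ioc 0 y', ∑ m ∈ Finset.Icc 1 6, (1 / (m.factorial : ℝ)) *
        cpow (fun t : ℝ => if ν < t then 1 / t else 0) m t := by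
  refine setIntegral_mono_set ((locBdd_buchstabPhi hν 6).integrableOn_Ioc 0 y') ?_ ?_
  · exact Filter.Eventually.of_forall fun t => buchstabPhi_nonneg hν.le 6 t
  · exact Filter.Eventually.of_forall (Set.Ioc_subset_Ioc_right hyy')

/-- `Ψ(y) = 0` for `y ≤ ν`. [folklore] -/
theorem buchstabPsi_eq_zero_of_le {ν : ℝ} (hν : 0 < ν) {y : ℝ} (hy : y ≤ ν) :
    ∫ t in Set.Ioc 0 y, ∑ m ∈ Finset.Icc 1 6, (1 / (m.factorial : ℝ)) *
        cpow (fun t : ℝ => if ν < t then 1 / t else 0) m t = 0 := by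
  refine setIntegral_eq_zero_of_forall_eq_zero fun t ht => ?_
  exact buchstabPhi_eq_zero_of_le hν 6 (ht.2.trans hy)

end Summit.Parity.GeneralizedHardyLittlewood.FordMaynardSieveConst01651SieveConst01651

end
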